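import Literature.NumberTheory.EllipticCurves.BinaryQuarticMeasure
import Literature.NumberTheory.EllipticCurves.BinaryQuarticStabilizer
import Mathlib.MeasureTheory.Group.Measure
import Mathlib.Topology.Algebra.Module.Basic
import HarnessLib

/-!
# `V_R = R⁵` as an `R`-module of binary quartic forms; Haar measure and residue classes on `V_{ℤ_p}`

Topic `Literature/NumberTheory/EllipticCurves`; continues `BinaryQuarticForms.lean`,
`BinaryQuarticLocalSolubility.lean` (topology of `V_R`), `BinaryQuarticMeasure.lean` (the measure
`μ_p` on `V_{ℤ_p}`, Lebesgue measure on `V_ℝ`) and `BinaryQuarticStabilizer.lean` (coefficientwise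
addition), for M. Bhargava, A. Shankar, *Binary quartic forms having bounded invariants, and the
boundedness of the average rank of elliptic curves*, Ann. of Math. (2) 181 (2015) 191–242.

Bhargava–Shankar use throughout that `V_R` is the `R`-module `R⁵` of coefficient vectors: the lattice
`V_ℤ ⊂ V_ℝ` and its sublattices `m · V_ℤ` and their translates ("`S` may be viewed as the union of
`k` translates `𝓛₁, …, 𝓛_k` of the lattice `m · V_ℤ`", §2.5 of the held arXiv text
`arXiv:1006.1002v2`), the normalised *additive* measure `μ_p` on `V_{ℤ_p}` (§2.5), and `p`-adic
densities of sets "defined by congruence conditions modulo `p^k`". This file supplies: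

* the `AddCommGroup` and `Module R` structures on `BinaryQuartic R` (coefficientwise; the scalar
  multiplication is the existing one of `BinaryQuarticForms.lean`, the addition that of
  `BinaryQuarticStabilizer.lean`), the linear equivalence `coeffsLinearEquiv : V_R ≃ₗ[R] R⁵`, and
  the instances `IsTopologicalAddGroup`, `ContinuousSMul` for a topological ring `R`;
* **`μ_p` is a Haar measure on the compact group `V_{ℤ_p}`** and Lebesgue measure is a Haar
  measure on `V_ℝ`: one generic instance `instIsAddHaarMeasure` (the volume on `V_R` is a Haar
  measure whenever the volume on `R` is), covering both `R = ℤ_p` and `R = ℝ`;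
* **the measure of a residue class**: `μ_p {g ≡ f (mod p^k)} = p^{−5k}`
  (`padicInt_volume_setOf_norm_sub_le`, `padicInt_volume_setOf_pow_dvd_sub`), the basic input for
  `p`-adic densities of congruence-defined sets (Thm 2.11 of the source).

## References

* M. Bhargava, A. Shankar, Ann. of Math. (2) 181 (2015) 191–242 = arXiv:1006.1002, §2.5
  (lattices `m·V_ℤ`, the additive measure `μ_p` on `V_{ℤ_p}`, `p`-adic densities).
  [cite: BhargavaShankarAnnals2015, §2.5 (μ_p, congruence conditions; arXiv:1006.1002v2 numbering)]

## Design

No named facts. The new instances are on the project structure `BinaryQuartic` only; `add` and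
`smul` are the pre-existing operations, so no diamonds arise with `BinaryQuartic.instAdd`,
`BinaryQuartic.instMulAction`.
-/

noncomputable section

open scoped Classical
open MeasureTheory TopologicalSpace Metric Set
open scoped ENNReal

namespace Literature.NumberTheory.EllipticCurves

namespace BinaryQuartic

/-! ## The module structure -/

section Module

variable {R : Type*} [CommRing R]

/-- The zero form. [folklore] -/
instance instZero : Zero (BinaryQuartic R) := ⟨⟨0, 0, 0, 0, 0⟩⟩

/-- Coefficientwise negation. [folklore] -/
instance instNeg : Neg (BinaryQuartic R) := ⟨fun f ↦ ⟨-f.a, -f.b, -f.c, -f.d, -f.e⟩⟩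

/-- Coefficientwise subtraction. [folklore] -/
instance instSub : Sub (BinaryQuartic R) := ⟨fun f g ↦ ⟨f.a - g.a, f.b - g.b, f.c - g.c, f.d - g.d, f.e - g.e⟩⟩

/-- `0.a = 0` (definitional). [folklore] -/
@[simp] theorem zero_a : (0 : BinaryQuartic R).a = 0 := rfl
/-- `0.b = 0` (definitional). [folklore] -/
@[simp] theorem zero_b : (0 : BinaryQuartic R).b = 0 := rfl
/-- `0.c = 0` (definitional). [folklore] -/
@[simp] theorem zero_c : (0 : BinaryQuartic R).c = 0 := rfl
/-- `0.d = 0` (definitional). [folklore] -/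
@[simp] theorem zero_d : (0 : BinaryQuartic R).d = 0 := rfl
/-- `0.e = 0` (definitional). [folklore] -/
@[simp] theorem zero_e : (0 : BinaryQuartic R).e = 0 := rfl
/-- Negation on `a` (definitional). [folklore] -/
@[simp] theorem neg_a (f : BinaryQuartic R) : (-f).a = -f.a := rfl
/-- Negation on `b` (definitional). [folklore] -/
@[simp] theorem neg_b (f : BinaryQuartic R) : (-f).b = -f.b := rfl
/-- Negation on `c` (definitional). [folklore] -/
@[simp] theorem neg_c (f : BinaryQuartic R) : (-f).c = -f.c := rfl
/-- Negation on `d` (definitional). [folklore] -/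
@[simp] theorem neg_d (f : BinaryQuartic R) : (-f).d = -f.d := rfl
/-- Negation on `e` (definitional). [folklore] -/
@[simp] theorem neg_e (f : BinaryQuartic R) : (-f).e = -f.e := rfl
/-- Subtraction on `a` (definitional). [folklore] -/
@[simp] theorem sub_a (f g : BinaryQuartic R) : (f - g).a = f.a - g.a := rfl
/-- Subtraction on `b` (definitional). [folklore] -/
@[simp] theorem sub_b (f g : BinaryQuartic R) : (f - g).b = f.b - g.b := rfl
/-- Subtraction on `c` (definitional). [folklore] -/
@[simp] theorem sub_c (f g : BinaryQuartic R) : (f - g).c = f.c - g.c := rfl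
/-- Subtraction on `d` (definitional). [folklore] -/
@[simp] theorem sub_d (f g : BinaryQuartic R) : (f - g).d = f.d - g.d := rfl
/-- Subtraction on `e` (definitional). [folklore] -/
@[simp] theorem sub_e (f g : BinaryQuartic R) : (f - g).e = f.e - g.e := rfl

/-- **`V_R` is an abelian group** under coefficientwise addition (the additive group `R⁵`); `ℕ`- and
`ℤ`-scalar multiplications are also coefficientwise, so that for `R = ℤ` Mathlib's
`AddCommGroup.toIntModule` agrees definitionally with `instModule` (no diamond on `V_ℤ`).
[folklore] -/
instance instAddCommGroup : AddCommGroup (BinaryQuartic R) where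
  add := (· + ·)
  add_assoc f g h := by ext <;> simp [add_assoc]
  zero := 0
  zero_add f := by ext <;> simp
  add_zero f := by ext <;> simp
  nsmul k f := ⟨k • f.a, k • f.b, k • f.c, k • f.d, k • f.e⟩
  nsmul_zero _ := by ext <;> exact AddMonoid.nsmul_zero _
  nsmul_succ _ _ := by ext <;> exact AddMonoid.nsmul_succ _ _
  neg := Neg.neg
  sub := Sub.sub
  sub_eq_add_neg f g := by ext <;> simp [sub_eq_add_neg]
  zsmul k f := ⟨k • f.a, k • f.b, k • f.c, k • f.d, k • f.e⟩
  zsmul_zero' _ := by ext <;> exact SubNegMonoid.zsmul_zero' _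
  zsmul_succ' _ _ := by ext <;> exact SubNegMonoid.zsmul_succ' _ _
  zsmul_neg' _ _ := by ext <;> exact SubNegMonoid.zsmul_neg' _ _
  neg_add_cancel f := by ext <;> simp
  add_comm f g := by ext <;> simp [add_comm]

/-- **`V_R` is an `R`-module** (the free module `R⁵`), with the scalar multiplication of
`BinaryQuarticForms.lean`. [folklore] -/
instance instModule : Module R (BinaryQuartic R) where
  smul := (· • ·)
  one_smul f := by ext <;> simp
  mul_smul μ ν f := by ext <;> simp [mul_assoc]
  smul_zero μ := by ext <;> simp
  smul_add μ f g := by ext <;> simp [mul_add]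
  add_smul μ ν f := by ext <;> simp [add_mul]
  zero_smul f := by ext <;> simp

/-- The coefficient map is additive. [folklore] -/
@[simp] theorem coeffs_add (f g : BinaryQuartic R) : (f + g).coeffs = f.coeffs + g.coeffs := by
  funext i; fin_cases i <;> rfl

/-- The coefficient map is `R`-linear. [folklore] -/
@[simp] theorem coeffs_smul (μ : R) (f : BinaryQuartic R) : (μ • f).coeffs = μ • f.coeffs := by
  funext i; fin_cases i <;> rfl

/-- `coeffs 0 = 0`. [folklore] -/
@[simp] theorem zero_coeffs : (0 : BinaryQuartic R).coeffs = 0 := by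
  funext i; fin_cases i <;> rfl

/-- `coeffs (−f) = −coeffs f`. [folklore] -/
@[simp] theorem coeffs_neg (f : BinaryQuartic R) : (-f).coeffs = -f.coeffs := by
  funext i; fin_cases i <;> rfl

/-- `coeffs (f − g) = coeffs f − coeffs g`. [folklore] -/
@[simp] theorem coeffs_sub (f g : BinaryQuartic R) : (f - g).coeffs = f.coeffs - g.coeffs := by
  funext i; fin_cases i <;> rfl

/-- **`V_R ≃ₗ[R] R⁵`** by the coefficient vector. [folklore] -/
def coeffsLinearEquiv : BinaryQuartic R ≃ₗ[R] (Fin 5 → R) :=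
  { equivFin5 with
    map_add' := coeffs_add
    map_smul' := coeffs_smul }

/-- The linear equivalence is the coefficient map (definitional). [folklore] -/
@[simp] theorem coeffsLinearEquiv_apply (f : BinaryQuartic R) : coeffsLinearEquiv f = f.coeffs := rfl

/-- The inverse linear equivalence is the inverse coefficient map (definitional). [folklore] -/
@[simp] theorem coeffsLinearEquiv_symm_apply (v : Fin 5 → R) :
    (coeffsLinearEquiv (R := R)).symm v = equivFin5.symm v := rfl

/-- Evaluation is additive in the form. [folklore] -/
theorem eval_add (f g : BinaryQuartic R) (x y : R) : (f + g).eval x y = f.eval x y + g.eval x y := by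
  simp only [eval, add_a, add_b, add_c, add_d, add_e]; ring

end Module

/-! ## Topological module structure -/

section Topology

variable {R : Type*} [CommRing R] [TopologicalSpace R] [IsTopologicalRing R]

/-- Addition on `V_R` is continuous. [folklore] -/
instance instContinuousAdd : ContinuousAdd (BinaryQuartic R) := by
  refine ⟨?_⟩
  rw [continuous_iff]
  simp only [add_a, add_b, add_c, add_d, add_e]
  exact ⟨by fun_prop, by fun_prop, by fun_prop, by fun_prop, by fun_prop⟩

/-- Negation on `V_R` is continuous. [folklore] -/
instance instContinuousNeg : ContinuousNeg (BinaryQuartic R) := by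
  refine ⟨?_⟩
  rw [continuous_iff]
  simp only [neg_a, neg_b, neg_c, neg_d, neg_e]
  exact ⟨by fun_prop, by fun_prop, by fun_prop, by fun_prop, by fun_prop⟩

/-- **`V_R` is a topological additive group.** [folklore] -/
instance instIsTopologicalAddGroup : IsTopologicalAddGroup (BinaryQuartic R) where
  toContinuousAdd := inferInstance
  toContinuousNeg := inferInstance

/-- Scalar multiplication `R × V_R → V_R` is continuous. [folklore] -/
instance instContinuousSMul : ContinuousSMul R (BinaryQuartic R) := by
  refine ⟨?_⟩
  rw [continuous_iff]
  simp only [smul_a, smul_b, smul_c, smul_d, smul_e]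
  exact ⟨by fun_prop, by fun_prop, by fun_prop, by fun_prop, by fun_prop⟩

omit [IsTopologicalRing R] in
/-- `V_R ≃ R⁵` as a homeomorphic additive equivalence. [folklore] -/
theorem continuous_coeffsLinearEquiv_symm :
    Continuous ((coeffsLinearEquiv (R := R)).symm : (Fin 5 → R) → BinaryQuartic R) :=
  (homeomorphFin5 (R := R)).symm.continuous

end Topology

/-! ## Haar measure on `V_{ℤ_p}` and on `V_ℝ` -/

section Haar

variable {R : Type*} [CommRing R] [TopologicalSpace R] [IsTopologicalRing R] [MeasureSpace R]
  [BorelSpace R] [SecondCountableTopology R] [(volume : Measure R).IsAddHaarMeasure]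
  [SigmaFinite (volume : Measure R)]

/-- **The measure on `V_R` is a Haar measure** whenever `volume` on `R` is (push-forward of the
product Haar measure along the additive homeomorphism `R⁵ ≃ V_R`): e.g. `μ_p` on `V_{ℤ_p}`
(Bhargava–Shankar's "additive measure", §2.5) and Lebesgue measure on `V_ℝ`.
[cite: BhargavaShankarAnnals2015, §2.5 (the additive measure μ_p on V_{ℤ_p}; arXiv:1006.1002v2 numbering)] -/
instance instIsAddHaarMeasure : (volume : Measure (BinaryQuartic R)).IsAddHaarMeasure := by
  rw [volume_eq]
  exact AddEquiv.isAddHaarMeasure_map (volume : Measure (Fin 5 → R))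
    (coeffsLinearEquiv (R := R)).symm.toAddEquiv continuous_coeffsLinearEquiv_symm
    continuous_coeffs

end Haar

/-! ## Residue classes in `V_{ℤ_p}` -/

section Padic

variable {p : ℕ} [Fact p.Prime]

/-- The residue class `{g ≡ f (mod p^k)}` of `V_{ℤ_p}` is, in coefficients, the box
`∏ᵢ B̄(fᵢ, p^{−k})`. [folklore] -/
theorem image_coeffs_setOf_norm_sub_le (f : BinaryQuartic ℤ_[p]) (k : ℕ) :
    coeffs '' {g : BinaryQuartic ℤ_[p] | ∀ i, ‖g.coeffs i - f.coeffs i‖ ≤ (p : ℝ) ^ (-(k : ℤ))} =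
      Set.pi univ fun i ↦ closedBall (f.coeffs i) ((p : ℝ) ^ (-(k : ℤ))) := by
  ext v
  simp only [mem_image, mem_setOf_eq, mem_univ_pi, mem_closedBall, dist_eq_norm]
  constructor
  · rintro ⟨g, hg, rfl⟩; exact hg
  · intro hv
    refine ⟨equivFin5.symm v, fun i ↦ ?_, equivFin5.apply_symm_apply v⟩
    rw [show (equivFin5.symm v).coeffs = v from equivFin5.apply_symm_apply v]
    exact hv i

/-- **`μ_p {g ∈ V_{ℤ_p} : g ≡ f (mod p^k)} = p^{−5k}`** (coefficientwise congruence,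
`‖gᵢ − fᵢ‖ ≤ p^{−k}`): the density of a residue class modulo `p^k` in `V_{ℤ_p}`.
[cite: BhargavaShankarAnnals2015, §2.5 (p-adic densities of congruence classes; arXiv:1006.1002v2 numbering)] -/
theorem padicInt_volume_setOf_norm_sub_le (f : BinaryQuartic ℤ_[p]) (k : ℕ) :
    volume {g : BinaryQuartic ℤ_[p] | ∀ i, ‖g.coeffs i - f.coeffs i‖ ≤ (p : ℝ) ^ (-(k : ℤ))} =
      (((p : ℝ≥0∞) ^ k)⁻¹) ^ 5 := by
  rw [volume_eq_volume_image_coeffs, image_coeffs_setOf_norm_sub_le, volume_pi, Measure.pi_pi]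
  simp only [Literature.MeasureTheory.Group.padicInt_volume_closedBall, Finset.prod_const,
    Finset.card_univ, Fintype.card_fin]

/-- The same residue class written with divisibility: `p^k ∣ gᵢ − fᵢ` for all `i`. [folklore] -/
theorem setOf_pow_dvd_sub_eq (f : BinaryQuartic ℤ_[p]) (k : ℕ) :
    {g : BinaryQuartic ℤ_[p] | ∀ i, (p : ℤ_[p]) ^ k ∣ g.coeffs i - f.coeffs i} =
      {g : BinaryQuartic ℤ_[p] | ∀ i, ‖g.coeffs i - f.coeffs i‖ ≤ (p : ℝ) ^ (-(k : ℤ))} := by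
  ext g
  simp only [mem_setOf_eq]
  refine forall_congr' fun i ↦ ?_
  rw [PadicInt.norm_le_pow_iff_mem_span_pow, Ideal.mem_span_singleton]

/-- **`μ_p {g : p^k ∣ g − f coefficientwise} = p^{−5k}`.** [cite: BhargavaShankarAnnals2015, §2.5 (p-adic densities of congruence classes; arXiv:1006.1002v2 numbering)] -/
theorem padicInt_volume_setOf_pow_dvd_sub (f : BinaryQuartic ℤ_[p]) (k : ℕ) :
    volume {g : BinaryQuartic ℤ_[p] | ∀ i, (p : ℤ_[p]) ^ k ∣ g.coeffs i - f.coeffs i} =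
      (((p : ℝ≥0∞) ^ k)⁻¹) ^ 5 := by
  rw [setOf_pow_dvd_sub_eq, padicInt_volume_setOf_norm_sub_le]

/-- Translation invariance of `μ_p` on `V_{ℤ_p}` (a Haar measure): `μ_p(f + S) = μ_p(S)`. [folklore] -/
theorem padicInt_volume_image_add (f : BinaryQuartic ℤ_[p]) (S : Set (BinaryQuartic ℤ_[p])) :
    volume ((fun g ↦ f + g) '' S) = volume S := by
  rw [image_add_left, measure_preimage_add]

end Padic

end BinaryQuartic

end Literature.NumberTheory.EllipticCurves

end
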